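import Summits.QuantumFields.BalabanUV.T4Continuum.Support.TorusBlockRefinement

/-!
# T⁴ programme (cell `pub-balaban`, sub-cell `t4`) — THE BLOCK REFINEMENT IS LIVE AND STRICT: the refinement of one block has EXACTLY
# `L^d` fine cubes, and for `L ≥ 3`, `d ≥ 1` its tree length is STRICTLY larger than the block's (`0 < torusTreeLen (trefine L N' {b})`)

Crew seat `b2b-balaban-t4-ne1p-formalise-leaf-05` (LEAF PROVER 05, generation 11), NE1′ formalisation crew; sibling of S43 PART 1
`Support/TorusBlockRefinement` (p233746) — NEW theorems only, S43's ✓✓ bytes untouched (INTENT `CLAIMS.log` 2026-08-20).  OUR lattice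
arithmetic, Summits-side; imports S43 PART 1 ONLY (pv22's `TreeLengthTorus*` and b16's `B16Ineq197ClassOne` in its cone); nothing restated.

WHY THIS FILE.  S43 discharged the two-tori faces' `foot`∕`hmono` with the INEQUALITY `torusTreeLen Z.1 ≤ torusTreeLen (trefineDom L N Z).1`
(factor 1 of the (2.36)-KIND direction).  The typer's reader test for the two-scale witnesses (R-T126, X160 «R5: the strict refinement is
REFUTED at `foot = id`») asks whether a footprint map can be STRICTLY finer.  For the constructed refinement it is, as soon as `L ≥ 3`:
§1 the refinement of a single block is the projection of b16's window box `fineCubes L {natLift b}`, on which the covering projection is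
INJECTIVE (the box lies in the fundamental domain `[0, L·N′)^d`), hence **`card_trefine_singleton : (trefine L N' {b}).card = L ^ d`** (the
EXACT fibre count of the block map; the crew's S44 carries the inequality `≤ L^d`); §2 pv22's volume bound `card_le_torusTreeLen`
(`#X̄ ≤ 2^d·(4·d(X̄) + 1)`) then gives `((L/2)^d − 1)/4 ≤ torusTreeLen (trefine L N' {b})`, while `torusTreeLen {b} = 0`
(`torusTreeLen_singleton`) — so for `L ≥ 3`, `d ≥ 1` the refinement of a unit block is STRICTLY longer: **`torusTreeLen_lt_trefine_singleton`**.
At `L = 1` (the crew's `foot := id` toys) and `L = 2` the volume bound gives nothing — consistent with R5's refutation at `foot = id`.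
HONEST FRAMING.  Elementary lattice arithmetic on pv22's periodic index model; no statement of the audited manuscripts is asserted (print's
`L` is «an odd positive integer > 11», [Balaban1987RGI] p. 251 — TYPE∕CONTEXT; pv22's (2.36) substitute needs `L ≥ 3`); WHICH pair of
nested tori is Bałaban's `(𝐃_{k+1}, 𝐃_k)` stays pv22's READING (D-pv22.3); [folklore] tags only.  Nothing of NE1′'s wall moves (v1.7 of
record, T4-DAG v47); NE1′ ⇐ the named binders — NOT printed, NOT proved; spine PROVED 0∕9; count 9 unchanged.  Rung (B)+1 on ONE finite
four-torus — NOT infinite volume, NOT a mass gap, NOT OS on ℝ⁴, NOT Clay.  HONEST DEPENDENCY: continuum YM on T⁴ ⇐ BetaPertH ∧ nine spine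
estimates (0/9 proved); BetaPertH ⇐ (D1) ∧ (D4) ∧ CAP+tail; G-an2-4 gates asym, D1 and NE2/3/4.
-/

namespace Summit.QuantumFields.BalabanUV.T4Continuum.TorusBlockRefinementCard

open Literature.MathematicalPhysics.QuantumFieldTheory.Balaban1983to89.B13ScaleTransfer (Pt coarse)
open Literature.MathematicalPhysics.QuantumFieldTheory.Balaban1983to89.TreeLengthTorus (TPt proj natLift proj_natLift TFaceConnected TDom
  torusTreeLen torusTreeLen_nonneg torusTreeLen_singleton card_le_torusTreeLen)
open Literature.MathematicalPhysics.QuantumFieldTheory.Balaban1983to89.B13Factor210Literal (fineCubes)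
open Literature.MathematicalPhysics.QuantumFieldTheory.Balaban1983to89.B16Ineq197ClassOne (mem_fineCubes_coarse mem_fineCubes_singleton
  card_fineCubes_singleton)
open Literature.MathematicalPhysics.QuantumFieldTheory.Balaban1983to89.TreeLengthTorusTransfer (tcoarse)
open Summit.QuantumFields.BalabanUV.T4Continuum.TorusBlockRefinement (trefine trefineDom mem_trefine image_fineCubes_subset_trefine
  natLift_nonneg_lt natLift_proj_of_range coarse_natLift trefine_nonempty tFaceConnected_trefine)

variable {d : ℕ} {L N' : ℕ} [NeZero L] [NeZero N']

/-! ## §1 The refinement of one block: `L^d` fine cubes exactly -/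

/-- The refinement of a single block `b` is the projection of the window box `fineCubes L {natLift b}` of the universal cover. [folklore] -/
theorem trefine_singleton_eq_image (b : TPt d N') :
    trefine L N' {b} = (fineCubes L ({natLift b} : Finset (Pt d))).image (proj (L * N')) := by
  have hL : 0 < L := Nat.pos_of_ne_zero (NeZero.ne L)
  refine Finset.Subset.antisymm (fun a ha => ?_)
    (image_fineCubes_subset_trefine fun β hβ => by
      rw [Finset.mem_singleton] at hβ; subst hβ; rw [proj_natLift]; exact Finset.mem_singleton_self _)
  have hb : tcoarse L N' a ∈ ({b} : Finset (TPt d N')) := mem_trefine.1 ha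
  refine Finset.mem_image.2 ⟨natLift a, (mem_fineCubes_coarse hL).2 ?_, proj_natLift a⟩
  rw [Finset.mem_singleton, coarse_natLift, Finset.mem_singleton.1 hb]

/-- The window box of a block whose index is a standard lift lies in the fundamental domain `[0, L·N′)^d` of the fine torus. [folklore] -/
theorem fineCubes_natLift_range (b : TPt d N') {x : Pt d} (hx : x ∈ fineCubes L ({natLift b} : Finset (Pt d))) (i : Fin d) :
    0 ≤ x i ∧ x i < (L * N' : ℕ) := by
  have hL : 0 < L := Nat.pos_of_ne_zero (NeZero.ne L)
  have hL' : (0 : ℤ) ≤ L := by exact_mod_cast hL.le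
  obtain ⟨h1, h2⟩ := (mem_fineCubes_singleton hL).1 hx i
  obtain ⟨hb0, hbN⟩ := natLift_nonneg_lt b i
  refine ⟨le_trans (mul_nonneg hL' hb0) h1, ?_⟩
  have h3 : (L : ℤ) * natLift b i + L ≤ (L : ℤ) * N' := by
    have : natLift b i + 1 ≤ (N' : ℤ) := by omega
    nlinarith
  push_cast
  linarith

/-- The covering projection is injective on the window box of a block (the box lies in a fundamental domain). [folklore] -/
theorem injOn_proj_fineCubes_natLift (b : TPt d N') :
    Set.InjOn (proj (L * N')) (fineCubes L ({natLift b} : Finset (Pt d)) : Set (Pt d)) := by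
  intro x hx y hy hxy
  have hx' := natLift_proj_of_range (fineCubes_natLift_range b (Finset.mem_coe.1 hx))
  have hy' := natLift_proj_of_range (fineCubes_natLift_range b (Finset.mem_coe.1 hy))
  rw [← hx', ← hy', hxy]

/-- **THE EXACT FIBRE COUNT OF THE BLOCK MAP**: the refinement of one block of the coarse torus consists of exactly `L^d` cubes of the fine
torus (b16's `card_fineCubes_singleton` on the universal cover + injectivity of the projection on the box). [folklore] -/
theorem card_trefine_singleton (b : TPt d N') : (trefine L N' {b}).card = L ^ d := by
  have hL : 0 < L := Nat.pos_of_ne_zero (NeZero.ne L)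
  rw [trefine_singleton_eq_image, Finset.card_image_of_injOn (injOn_proj_fineCubes_natLift b), card_fineCubes_singleton hL]

/-! ## §2 The refinement of a unit block is STRICTLY longer than the block, for `L ≥ 3` -/

omit [NeZero N'] in
/-- A single cube is trivially torus-face-connected (so `⟨{b}, Finset.singleton_nonempty b, tFaceConnected_singleton b⟩ : TDom d N'` is
the unit block of the coarse catalogue, at which `trefineDom L N'` may be read). [folklore] -/
theorem tFaceConnected_singleton (b : TPt d N') : TFaceConnected ({b} : Finset (TPt d N')) := by
  intro x hx y hy
  rw [Finset.mem_singleton] at hx hy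
  subst hx; subst hy
  exact Relation.ReflTransGen.refl

/-- **A LOWER BOUND FOR THE REFINED UNIT BLOCK**: `((L/2)^d − 1)/4 ≤ torusTreeLen (trefine L N' {b})` — pv22's volume bound
`card_le_torusTreeLen` (`#X̄ ≤ 2^d·(4·d(X̄) + 1)`) at the `L^d` cubes of §1. [folklore] -/
theorem torusTreeLen_trefine_singleton_ge (b : TPt d N') :
    (((L : ℝ) / 2) ^ d - 1) / 4 ≤ torusTreeLen (trefine L N' {b}) := by
  have h := card_le_torusTreeLen (trefine_nonempty (L := L) (Finset.singleton_nonempty b))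
    (tFaceConnected_trefine (L := L) (tFaceConnected_singleton b))
  rw [card_trefine_singleton] at h
  push_cast at h
  have h2 : (0 : ℝ) < 2 ^ d := by positivity
  rw [div_pow]
  have h3 : (L : ℝ) ^ d / 2 ^ d ≤ 4 * torusTreeLen (trefine L N' {b}) + 1 := by
    rw [div_le_iff₀ h2]; linarith
  linarith

/-- **THE REFINEMENT IS STRICTLY FINER IN TREE LENGTH** (for `L ≥ 3`, `d ≥ 1`): the unit block has tree length `0` (pv22's
`torusTreeLen_singleton`) while its refinement has tree length `≥ ((L/2)^d − 1)/4 > 0` — the typer's strict-refinement test (R-T126 ∕ X160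
«R5», refuted at the toys' `foot := id`) PASSES for `foot := trefineDom L N'` at the unit block `⟨{b}, _, tFaceConnected_singleton b⟩`
(whose refinement's cubes ARE `trefine L N' {b}` by `trefineDom_val`). [folklore] -/
theorem torusTreeLen_lt_trefine_singleton (hL : 3 ≤ L) (hd : 1 ≤ d) (b : TPt d N') :
    torusTreeLen ({b} : Finset (TPt d N')) < torusTreeLen (trefine L N' {b}) := by
  rw [torusTreeLen_singleton]
  have hge := torusTreeLen_trefine_singleton_ge (L := L) (N' := N') b
  have h32 : (3 / 2 : ℝ) ≤ (L : ℝ) / 2 := by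
    have : (3 : ℝ) ≤ L := by exact_mod_cast hL
    linarith
  have hpow : (3 / 2 : ℝ) ^ d ≤ ((L : ℝ) / 2) ^ d := by gcongr
  have hone : (1 : ℝ) < (3 / 2 : ℝ) ^ d := one_lt_pow₀ (by norm_num) (by omega)
  linarith

/-- d = 4, L = 3 (the smallest admissible `L` of pv22's (2.36) substitute): the refined unit block has `81` cubes and tree length
`≥ (81/16 − 1)/4 = 65/64`. [arith] -/
example (b : TPt 4 N') : (trefine 3 N' {b}).card = 81 ∧ (65 / 64 : ℝ) ≤ torusTreeLen (trefine 3 N' {b}) := by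
  refine ⟨by simpa using card_trefine_singleton (L := 3) (N' := N') b, ?_⟩
  have h := torusTreeLen_trefine_singleton_ge (L := 3) (N' := N') b
  norm_num at h
  linarith

end Summit.QuantumFields.BalabanUV.T4Continuum.TorusBlockRefinementCard
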